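import Summits.ValiantsHypothesis.ValiantsHypothesis.Theorems.BarrierLeverSuccinctHittingSetsForVPKRSTEdgeTransversal
import Summits.ValiantsHypothesis.ValiantsHypothesis.Theorems.BarrierLeverSuccinctHittingSetsForVPLowDegreeEquations

/-!
# Crux `BarrierLever.SuccinctHittingSetsForVP` (stmt-ValiantsHypothesis-14610) — THE IDEAL DOOR AND THE
# PER-SEED WINDOW: annihilation, reconstructible generators, "overplanting kills succinctness"

Lean text authored by the cell planner seat `valiant-natproofs-p2` (gen 2, HOME/Sketch-p2g2.lean
§1–§4), landed by the prover seat as a helper of the crux, with the planner's mirrors of the door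
file replaced by imports (`IsIdealSuccinctGenerator` and `IsSuccinctGenerator.ideal` are taken from
`…KRSTEdgeTransversal.lean`). Unconditional; does NOT close the item. Cell `valiant-natproofs`, V4
(D-0053): this is the typed WINDOW inside which the per-seed succinctness door of the crux is open.

* `isSuccinctHittingSet_of_idealGenerator` — the door in its weakest form (ideal-succinct hitting set
  generator ⇒ succinct hitting set); `not_idealSuccinct_iff` — dichotomy for a fixed generator.
* `bind₁_eq_zero_of_succinct` — ANNIHILATION: a per-seed succinct generator is killed by every
  equation of the class; `not_isHittingSetGenerator_of_succinct_of_equation`.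
* `Reconstructible G L T`, `MonotoneThreshold T` — the output shape of the Kabanets–Impagliazzo
  argument (`Literature/Computability/AlgebraicComplexity/KabanetsImpagliazzoHardness.lean`:
  `complexity_le_of_kiGenerator_annihilated` says `Reconstructible (kiGenerator f e) (L f) T` with
  `T s Δ = (s + #ι(deg f+1)^r(2 deg f+2) + Δ·max 1 (deg f) + deg f + #β + 4)^7`);
  `isHittingSetGenerator_of_reconstructible` (lower edge: hardness above threshold ⇒ hitting),
  `base_le_of_idealSuccinct`, `not_idealSuccinct_of_overplanted`, `window` (upper edge: an
  equation of the class caps the base complexity of an ideal-succinct reconstructible generator).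
* Over `ℂ` with the tree's quasi-polynomial equations (`LowDegreeEquations.exists_equation`):
  `base_le_of_idealSuccinct_smallCircuits`, `not_succinct_smallCircuits_of_overplanted`,
  `window_smallCircuits` — a reconstructive derivation of FSV Question 6 at level `a ↦ b` through a
  per-seed `SmallCircuits ℂ n b`-succinct generator must plant hardness `L` with
  `T(N^a, N^a) < L ≤ T(2^{n^c}, n^c)`, `c = c(b)`.
* `IdealSuccinctGeneratorsForVP`, `succinctHittingSetsForVP_of_idealGenerators`,
  `idealGenerators_of_generators` — the ideal door, asymptotic form.

WHAT THIS IS NOT: not a proof or refutation of FSV Question 6 / the crux; not a lower bound.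

References: [ForbesShpilkaVolk2018] Def. 7, Lemma 14, Question 6; [KumarRamyaSaptharishiTengse2022]
Lemma 8.
-/

-- layout Summits/ValiantsHypothesis/ValiantsHypothesis forces the duplicated namespace component
set_option linter.dupNamespace false

noncomputable section

namespace Summit.ValiantsHypothesis.ValiantsHypothesis.Theorems.BarrierLever.SuccinctHittingSetsForVP

namespace IdealWindow

open Literature.Barriers.ValiantsHypothesis Literature.Computability.AlgebraicComplexity MvPolynomial
open Summit.ValiantsHypothesis.ValiantsHypothesis.Theorems.BarrierLever.SuccinctHittingSetsForVP
open KRSTEdge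

/-! ### 1. Ideal (border) succinctness — the weakest door -/

section Ideal

variable {F : Type*} [CommSemiring F] {σ τ : Type*} {M : Set (σ →₀ ℕ)}

/-- Ideal succinctness survives enlarging the simple class. -/
theorem IsIdealSuccinctGenerator.mono {𝒞 𝒞' : Set (MvPolynomial σ F)} {G : M → MvPolynomial τ F}
    (h : IsIdealSuccinctGenerator M 𝒞 G) (h𝒞 : 𝒞 ⊆ 𝒞') : IsIdealSuccinctGenerator M 𝒞' G :=
  fun D hD => h D fun f hf => hD f (h𝒞 hf)

/-- **The door in its weakest form** (any commutative semiring): an ideal-succinct hitting set generator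
for `𝒟` makes `𝒞` a succinct hitting set for `𝒟`. (FSV Lemma 14 asks per-seed succinctness; only the
annihilator ideal of `G` versus the vanishing ideal of `coeff(𝒞)` matters.) -/
theorem isSuccinctHittingSet_of_idealGenerator {𝒞 : Set (MvPolynomial σ F)}
    {𝒟 : Set (MvPolynomial M F)} {G : M → MvPolynomial τ F} (hgen : IsHittingSetGenerator 𝒟 G)
    (hsucc : IsIdealSuccinctGenerator M 𝒞 G) : IsSuccinctHittingSet M 𝒞 𝒟 := by
  intro D hD hD0
  by_contra h
  push Not at h
  exact hgen D hD hD0 (hsucc D h)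

/-- **Dichotomy for a fixed generator.** `G` fails the weakest door iff some equation of `coeff(𝒞)` — of
ANY size and degree — does not annihilate `G` (over an infinite field: does not vanish at some output
`G(a)`), i.e. iff `image(G)` is not contained in the closure of `coeff(𝒞)`. -/
theorem not_idealSuccinct_iff {𝒞 : Set (MvPolynomial σ F)} {G : M → MvPolynomial τ F} :
    ¬ IsIdealSuccinctGenerator M 𝒞 G ↔
      ∃ D : MvPolynomial M F, (∀ f ∈ 𝒞, eval (coeffVector M f) D = 0) ∧ bind₁ G D ≠ 0 := by
  simp only [IsIdealSuccinctGenerator, not_forall, exists_prop]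

end Ideal

section IdealField

variable {F : Type*} [Field F] [Infinite F] {σ τ : Type*} {M : Set (σ →₀ ℕ)}

/-- **Annihilation.** Over an infinite field a PER-SEED succinct generator (FSV Def. 7(2)) is killed by
every equation of the class: if `D` vanishes at `coeff(f)` for all `f ∈ 𝒞` then `D ∘ G = 0` — because
`(D ∘ G)(a) = D(coeff f_a) = 0` at every seed `a`, and a polynomial vanishing everywhere is zero. -/
theorem bind₁_eq_zero_of_succinct {𝒞 : Set (MvPolynomial σ F)} {G : M → MvPolynomial τ F}
    (hsucc : IsSuccinctGenerator M 𝒞 G) {D : MvPolynomial M F}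
    (hvan : ∀ f ∈ 𝒞, eval (coeffVector M f) D = 0) : bind₁ G D = 0 := by
  refine MvPolynomial.funext fun a => ?_
  obtain ⟨f, hf, hfa⟩ := hsucc a
  rw [eval_bind₁_eq_eval_genOutput, ← hfa, hvan f hf, map_zero]

omit [Infinite F] in
/-- Hence an ideal-succinct (a fortiori per-seed succinct) generator CANNOT hit any class containing an
equation of `coeff(𝒞)`:
hitting and succinctness are in tension exactly along the vanishing ideal of the class. -/
theorem not_isHittingSetGenerator_of_succinct_of_equation {𝒞 : Set (MvPolynomial σ F)}
    {𝒟 : Set (MvPolynomial M F)} {G : M → MvPolynomial τ F} (hsucc : IsIdealSuccinctGenerator M 𝒞 G)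
    {D : MvPolynomial M F} (hD : D ∈ 𝒟) (hD0 : D ≠ 0)
    (hvan : ∀ f ∈ 𝒞, eval (coeffVector M f) D = 0) : ¬ IsHittingSetGenerator 𝒟 G :=
  fun hgen => hgen D hD hD0 (hsucc D hvan)

end IdealField

/-! ### 2. Reconstructible generators and the window -/

section Window

variable {F : Type*} [CommSemiring F] {σ τ : Type*} {M : Set (σ →₀ ℕ)}

/-- **Reconstructibility** of a generator `G` with BASE COMPLEXITY `L` and THRESHOLD `T`: every nonzero
annihilator `D` of `G` forces `L ≤ T (L(D)) (deg D)`. This is the exact output shape of the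
Kabanets–Impagliazzo argument: `complexity_le_of_kiGenerator_annihilated` (KI'03 Lemma 30 / KRST Lemma 8,
unconditional in the tree via the root closure) states `Reconstructible (kiGenerator f e) (complexity f) T`
with `T s Δ = (s + #ι·(deg f+1)^r·(2 deg f+2) + Δ·max 1 (deg f) + deg f + #β + 4)^7` for an `r`-design `e`.
Any future "hardness ⇒ hitting" argument by reconstruction has this shape with some `T`.
[cite: KumarRamyaSaptharishiTengse2022, Lemma 8] -/
def Reconstructible (G : M → MvPolynomial τ F) (L : ℕ) (T : ℕ → ℕ → ℕ) : Prop :=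
  ∀ D : MvPolynomial M F, D ≠ 0 → bind₁ G D = 0 → L ≤ T (complexity D) D.totalDegree

/-- Thresholds are monotone in (size, degree) — true for the KI threshold.
[cite: KumarRamyaSaptharishiTengse2022, Lemma 8] -/
def MonotoneThreshold (T : ℕ → ℕ → ℕ) : Prop :=
  ∀ ⦃s s' Δ Δ' : ℕ⦄, s ≤ s' → Δ ≤ Δ' → T s Δ ≤ T s' Δ'

/-- **Lower edge (the positive use): reconstruction + hardness above threshold ⇒ hitting.** If `G` is
reconstructible with base complexity `L > T s Δ`, then `G` is a hitting set generator for all nonzero `D`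
of size `≤ s` and degree `≤ Δ` (KRST Lemma 8 "HSG from hardness", abstract form). -/
theorem isHittingSetGenerator_of_reconstructible {G : M → MvPolynomial τ F} {L : ℕ} {T : ℕ → ℕ → ℕ}
    (hR : Reconstructible G L T) (hT : MonotoneThreshold T) {s Δ : ℕ} (hhard : T s Δ < L) :
    IsHittingSetGenerator {D : MvPolynomial M F | complexity D ≤ s ∧ D.totalDegree ≤ Δ} G := by
  intro D hD hD0 hann
  have h1 := hR D hD0 hann
  have h2 := hT hD.1 hD.2
  omega

/-- Level-`a` instance: hardness above `T (N^a) (N^a)` gives a generator for `Distinguishers F n a`. -/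
theorem isHittingSetGenerator_distinguishers_of_reconstructible {F : Type*} [Field F] {τ : Type*} {n a : ℕ}
    {G : degLEMonomials n → MvPolynomial τ F} {L : ℕ} {T : ℕ → ℕ → ℕ}
    (hR : Reconstructible G L T) (hT : MonotoneThreshold T)
    (hhard : T ((Nat.choose (2 * n) n) ^ a) ((Nat.choose (2 * n) n) ^ a) < L) :
    IsHittingSetGenerator (Distinguishers F n a) G :=
  isHittingSetGenerator_of_reconstructible hR hT hhard

/-- **Upper edge, abstract form: an equation of the class caps the base complexity of every
IDEAL-succinct reconstructible generator.** If `D ≠ 0` vanishes on `coeff(𝒞)` with `L(D) ≤ s`,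
`deg D ≤ Δ`, then `L ≤ T s Δ`. (Per-seed succinct generators are ideal-succinct: `IsSuccinctGenerator.ideal`.) -/
theorem base_le_of_idealSuccinct {𝒞 : Set (MvPolynomial σ F)} {G : M → MvPolynomial τ F} {L : ℕ}
    {T : ℕ → ℕ → ℕ} (hR : Reconstructible G L T) (hT : MonotoneThreshold T)
    (hsucc : IsIdealSuccinctGenerator M 𝒞 G) {D : MvPolynomial M F} (hD0 : D ≠ 0) {s Δ : ℕ}
    (hs : complexity D ≤ s) (hΔ : D.totalDegree ≤ Δ)
    (hvan : ∀ f ∈ 𝒞, eval (coeffVector M f) D = 0) : L ≤ T s Δ :=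
  (hR D hD0 (hsucc D hvan)).trans (hT hs hΔ)

/-- Contrapositive: a reconstructible generator planted ABOVE the equation threshold of the class is not
ideal-succinct, a fortiori not per-seed succinct — "overplanting kills succinctness". -/
theorem not_idealSuccinct_of_overplanted {𝒞 : Set (MvPolynomial σ F)} {G : M → MvPolynomial τ F} {L : ℕ}
    {T : ℕ → ℕ → ℕ} (hR : Reconstructible G L T) (hT : MonotoneThreshold T)
    {D : MvPolynomial M F} (hD0 : D ≠ 0) {s Δ : ℕ} (hs : complexity D ≤ s) (hΔ : D.totalDegree ≤ Δ)
    (hvan : ∀ f ∈ 𝒞, eval (coeffVector M f) D = 0) (hover : T s Δ < L) :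
    ¬ IsIdealSuccinctGenerator M 𝒞 G :=
  fun hsucc => absurd (base_le_of_idealSuccinct hR hT hsucc hD0 hs hΔ hvan) (not_le.2 hover)

/-- **The window.** A reconstructive derivation of hitting at level `(s₁, Δ₁)` (hardness `T s₁ Δ₁ < L`)
through a generator that is ideal-succinct for a class possessing an equation of size `≤ s₂` and degree
`≤ Δ₂` requires `T s₁ Δ₁ < T s₂ Δ₂`: the planted hardness must beat the distinguishers but NOT the class's
own equations. -/
theorem window {𝒞 : Set (MvPolynomial σ F)} {G : M → MvPolynomial τ F} {L : ℕ} {T : ℕ → ℕ → ℕ}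
    (hR : Reconstructible G L T) (hT : MonotoneThreshold T) (hsucc : IsIdealSuccinctGenerator M 𝒞 G)
    {s₁ Δ₁ : ℕ} (hhard : T s₁ Δ₁ < L) {D : MvPolynomial M F} (hD0 : D ≠ 0) {s₂ Δ₂ : ℕ}
    (hs : complexity D ≤ s₂) (hΔ : D.totalDegree ≤ Δ₂) (hvan : ∀ f ∈ 𝒞, eval (coeffVector M f) D = 0) :
    T s₁ Δ₁ < T s₂ Δ₂ :=
  hhard.trans_le (base_le_of_idealSuccinct hR hT hsucc hD0 hs hΔ hvan)

end Window

/-! ### 3. The upper edge over `ℂ`, instantiated with the tree's quasi-polynomial equations for `VP_{n,b}` -/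

section Complex

open Summit.ValiantsHypothesis.ValiantsHypothesis.Theorems.BarrierLever.SuccinctHittingSetsForVP

/-- **Upper edge for `SmallCircuits ℂ n b` (uses `LowDegreeEquations.exists_equation`, landed).** For every
succinctness exponent `b` there are `c = c(b)` (`= 20b+83` in the tree) and `n₀` such that for all `n ≥ n₀`:
EVERY reconstructible generator (any seed type, any base complexity `L`, any monotone threshold `T`) that is
ideal-succinct — in particular per-seed succinct — for `SmallCircuits ℂ n b` has `L ≤ T (2^(n^c)) (n^c)`.
For `KI-gen(per_M)` (root-closure exponent `7`) the right-hand side is `2^{O(n^c)}` (the design terms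
`N_n (M+1)^n (2M+2)` and `n^c · M` are dominated once `M ≤ 2^{n^{c-1}}`), so `2^{M^{1/k}}`-hardness of the
permanent is compatible with level-`b` succinctness only if `M^{1/k} = O(n^{c(b)})`: the succinctness
exponent must grow with `k = 1/ε`. -/
theorem base_le_of_idealSuccinct_smallCircuits (b : ℕ) : ∃ c n₀ : ℕ, ∀ n : ℕ, n₀ ≤ n →
    ∀ {τ : Type*} (G : degLEMonomials n → MvPolynomial τ ℂ) (L : ℕ) (T : ℕ → ℕ → ℕ),
      Reconstructible G L T → MonotoneThreshold T →
      IsIdealSuccinctGenerator (degLEMonomials n) (SmallCircuits ℂ n b) G →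
      L ≤ T (2 ^ (n ^ c)) (n ^ c) := by
  obtain ⟨c, n₀, h⟩ := LowDegreeEquations.exists_equation b
  refine ⟨c, n₀, fun n hn τ G L T hR hT hsucc => ?_⟩
  obtain ⟨D, hD0, hdeg, hsize, hvan⟩ := h n hn
  exact base_le_of_idealSuccinct hR hT hsucc hD0 hsize hdeg hvan

/-- **Overplanted generators are not `VP_{n,b}`-succinct (eventually in `n`, for each `b`).** -/
theorem not_succinct_smallCircuits_of_overplanted (b : ℕ) : ∃ c n₀ : ℕ, ∀ n : ℕ, n₀ ≤ n →
    ∀ {τ : Type*} (G : degLEMonomials n → MvPolynomial τ ℂ) (L : ℕ) (T : ℕ → ℕ → ℕ),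
      Reconstructible G L T → MonotoneThreshold T → T (2 ^ (n ^ c)) (n ^ c) < L →
      ¬ IsSuccinctGenerator (degLEMonomials n) (SmallCircuits ℂ n b) G := by
  obtain ⟨c, n₀, h⟩ := base_le_of_idealSuccinct_smallCircuits b
  refine ⟨c, n₀, fun n hn τ G L T hR hT hover hsucc => ?_⟩
  exact absurd (h n hn G L T hR hT (KRSTEdge.IsSuccinctGenerator.ideal hsucc)) (not_le.2 hover)

/-- **The window over `ℂ` at level `a ↦ b`.** If a reconstructible generator hits `Distinguishers ℂ n a` BY
RECONSTRUCTION (`T (N^a) (N^a) < L`) and is per-seed `SmallCircuits ℂ n b`-succinct, then (for `n ≥ n₀(b)`)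
`T (N^a) (N^a) < T (2^(n^c)) (n^c)` — with the KI threshold: `N^{7a} ≲ 2^{7 n^{c(b)}}`, always satisfiable by
taking `b` large, so the per-seed door is OPEN exactly in this window and nowhere else; no mechanism placing a
planted generator inside it is known (memo §B). -/
theorem window_smallCircuits (a b : ℕ) : ∃ c n₀ : ℕ, ∀ n : ℕ, n₀ ≤ n →
    ∀ {τ : Type*} (G : degLEMonomials n → MvPolynomial τ ℂ) (L : ℕ) (T : ℕ → ℕ → ℕ),
      Reconstructible G L T → MonotoneThreshold T →
      T ((Nat.choose (2 * n) n) ^ a) ((Nat.choose (2 * n) n) ^ a) < L →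
      IsSuccinctGenerator (degLEMonomials n) (SmallCircuits ℂ n b) G →
      T ((Nat.choose (2 * n) n) ^ a) ((Nat.choose (2 * n) n) ^ a) < T (2 ^ (n ^ c)) (n ^ c) := by
  obtain ⟨c, n₀, h⟩ := base_le_of_idealSuccinct_smallCircuits b
  refine ⟨c, n₀, fun n hn τ G L T hR hT hhard hsucc => ?_⟩
  exact hhard.trans_le (h n hn G L T hR hT (KRSTEdge.IsSuccinctGenerator.ideal hsucc))

end Complex

/-! ### 4. The ideal door, asymptotic form (equivalent to the hitting-set property up to the level shift of
the universal circuit; recorded so that successors type "border succinctness" uniformly) -/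

section IdealDoor

variable {F : Type*} [Field F] [Infinite F]

/-- `VP` admits IDEAL-succinct generators: for every level `a` some `b, n₀` and, for each `n ≥ n₀`, a hitting
set generator for `Distinguishers F n a` whose image lies in the closure of `coeff(SmallCircuits F n b)`.
[cite: ForbesShpilkaVolk2018, Def. 7 and Question 6] -/
def IdealSuccinctGeneratorsForVP (F : Type*) [Field F] [Infinite F] : Prop :=
  ∀ a : ℕ, ∃ b n₀ : ℕ, ∀ n : ℕ, n₀ ≤ n →
    ∃ (ℓ : ℕ) (G : degLEMonomials n → MvPolynomial (Fin ℓ) F),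
      IsHittingSetGenerator (Distinguishers F n a) G ∧
        IsIdealSuccinctGenerator (degLEMonomials n) (SmallCircuits F n b) G

/-- The weakest generator door implies FSV Question 6 (`SuccinctHittingSetsForVP`, crux 14610's statement). -/
theorem succinctHittingSetsForVP_of_idealGenerators (h : IdealSuccinctGeneratorsForVP F) :
    SuccinctHittingSetsForVP F := by
  intro a
  obtain ⟨b, n₀, hb⟩ := h a
  refine ⟨b, n₀, fun n hn => ?_⟩
  obtain ⟨ℓ, G, hgen, hsucc⟩ := hb n hn
  exact isSuccinctHittingSet_of_idealGenerator hgen hsucc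

/-- Per-seed generators (the landed door `SuccinctGeneratorsForVP`) are ideal generators. -/
theorem idealGenerators_of_generators (h : SuccinctGeneratorsForVP F) : IdealSuccinctGeneratorsForVP F := by
  intro a
  obtain ⟨b, n₀, hb⟩ := h a
  refine ⟨b, n₀, fun n hn => ?_⟩
  obtain ⟨ℓ, G, hgen, hsucc⟩ := hb n hn
  exact ⟨ℓ, G, hgen, (KRSTEdge.IsSuccinctGenerator.ideal hsucc)⟩

end IdealDoor

end IdealWindow

end Summit.ValiantsHypothesis.ValiantsHypothesis.Theorems.BarrierLever.SuccinctHittingSetsForVP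

end
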